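import Literature.Combinatorics.Extremal.PointLineInducedMatchings
import HarnessLib

/-!
# Proof of Pohoata's induced point–line matchings near exponent `3/2` (discharges `InducedMatchingsNearThreeHalves`)

This file discharges the named fact
`Literature.Combinatorics.Extremal.InducedMatchingsNearThreeHalves` of
`Literature/Combinatorics/Extremal/PointLineInducedMatchings.lean`
(`InducedMatchingsNearThreeHalves_holds`, at the end): for every prime `r ≥ 5` there are `c > 0`
and `q₀` such that for every prime `q ≥ q₀` with `q ≡ ±1 (mod r)` the plane `𝔽_q²` contains
`≥ c · q^{3/2 - 2/(r-1)}` points each lying on a line meeting the set only in that point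
(`IM(2,q) ≳_r q^{3/2 - 2/(r-1)}`).

Source, read at the locator: C. Pohoata, *The sharp exponent for the minimal distance problem*,
arXiv:2607.20422 (2026), Theorem 1.3 and §5 (Proposition 5.1 and the proof of Theorem 1.3,
pp. 10–12 of v2).  We FOLLOW the printed proof, in explicit coordinates:

* §2.1 of the paper (the induced-matching identity, Observation 2.1): we use the parabola
  `x = a + y²` with assigned line of normal `(1, -2y)`; for `p = (a + y², y)`, `p' = (a' + y'², y')`
  the incidence defect is `D(p, p') = (a' - a) + (y' - y)²` (`DD` below; the paper's `Q = 2x - y²`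
  differs by a harmless factor `2`).
* §3 (trace-zero sets, Prop. 3.2): with `ζ = ζ_r`, `d = (r-1)/2`, the real cyclotomic integers
  `b_i = ζ^i + ζ^{r-i}` (`bb`), the box `Y = {∑ n_i b_{i+1} : |n_i| ≤ M}` (`yy`) and the
  TRACE-ZERO box `A = {∑ m_i (b_{i+1} - b_1) : |m_i| ≤ M², m_0 = 0}` (`aa`; `Tr b_i = -1` for all
  `1 ≤ i ≤ r-1` is `sum_bb`).  Square-difference-freeness of `A` (`Tr(z²) = ∑ σ_j(z)² > 0`,
  Observation 3.1) becomes `claimA`: if all real conjugates of `D` vanish then `(a,y) = (a',y')`;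
  the linear independence of `b_1, …, b_d` needed to pass back to the integer parameters is proved
  through the Gram matrix of the trace form (`gram`, `indep`) instead of a power basis.
* Prop. 4.1/5.1 (the norm argument, displays (29)–(34)): `DD_ne_zero_of_reduction`.  The half
  norm `N = ∏_{j=1}^{d} σ_j(D)` (the norm from the real subfield `K = ℚ(ζ + ζ⁻¹)`) is shown to be
  a rational integer directly: it lies in `ℤ[ζ]` and is fixed by `Gal(ℚ(ζ)/ℚ) ≅ (ℤ/r)ˣ`, which
  permutes the index set `{1,…,d} ≅ (ℤ/r)ˣ/±1` (`fold`, `prod_fold_perm`); `|N| ≤ H^d` from the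
  archimedean bounds `|σ_j(D)| ≤ H` (`norm_DD_le`), and reduction modulo the degree-one prime
  `𝔮 = ker(ℤ[ζ] → 𝔽_q(η) , ζ ↦ η)` (a `PowerBasis.lift`) gives `q ∣ N` if `D ≡ 0 (mod 𝔮)`;
  with `H^d < q` this forces `D ≢ 0`, i.e. no off-diagonal incidence survives reduction.
* The splitting of `q ≡ ±1 (mod r)` in `K` (paper, end of §5, via Frobenius) is used in the
  concrete form `bb_mem_range`: `η^i + η^{-i}` is Frobenius-fixed, hence lies in the prime field
  (`mem_range_algebraMap_of_pow_eq`, root count of `X^q - X`), so the reduced points have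
  coordinates in `𝔽_q = ZMod q`.
* Proof of Thm. 1.3 (parameter choice): `M = ⌊q^{1/(2d)}/(5d)⌋`, `H = 24 d² M² < q^{1/d}`,
  `|V| = (2M²+1)^{d-1} (2M+1)^d ≥ q^{(3d-2)/(2d)} / ((5d)^{3d-2} 2^{d-1})` and
  `(3d-2)/(2d) = 3/2 - 2/(r-1)` (`count_bound`, `exists_inducedMatching`).

Deviations from the printed road, all inessential: the maximal real subfield `K` is never
materialised as a field (we work with explicit elements of `L = ℚ(ζ_r)`, any
`IsCyclotomicExtension {r} ℚ L`, and its automorphisms `IsCyclotomicExtension.fromZetaAut`);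
`𝒪_K`-lattice point counting (Fact 3.3) is replaced by the explicit parametrisation of sub-boxes
of `A_K(M²)` and `Y_K(M)` by integer vectors, which only needs the lower bound.  Only Mathlib is
used (cyclotomic extensions and their Galois group, `IsGalois.mem_range_algebraMap_iff_fixed`,
integrally closedness of `ℤ`, `PowerBasis.lift`, `Real.rpow`).

The auxiliary definitions `bb`, `yy`, `aa`, `DD`, `trz`, `fold` are the paper's explicit
objects in coordinates (grouped under `Pohoata2026`); no named facts are introduced.
-/

noncomputable section

namespace Literature.Combinatorics.Extremal

namespace Pohoata2026

open Finset

variable {S : Type*} [CommRing S]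

/-- `bb r z i = z ^ i + z ^ (r - i)`: at `z = ζ_r^j` this is the totally real cyclotomic integer
`σ_j(ζ^i + ζ^{-i}) = 2 cos(2π i j / r) ∈ 𝒪_K`, `K = ℚ(ζ_r + ζ_r⁻¹)`; at `z = η` (a primitive `r`-th
root of unity in characteristic `q`) it is its reduction.
[cite: Pohoata2026SharpExponentMinimalDistance, §3 and §5] -/
def bb (r : ℕ) (z : S) (i : ℕ) : S := z ^ i + z ^ (r - i)

/-- `yy r d z ν = ∑_{i<d} ν_i · bb r z (i + 1)`: the element of `𝒪_K` (resp. its conjugate /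
reduction) with integer coordinates `ν` in `b_1, …, b_d`; for `|ν_i| ≤ M` these parametrise a
sub-box of `Y_K(M)`. [cite: Pohoata2026SharpExponentMinimalDistance, §3 (23)] -/
def yy (r d : ℕ) (z : S) (ν : Fin d → ℤ) : S := ∑ i, (ν i : S) * bb r z (i.1 + 1)

/-- `aa r d z m = ∑_{i<d} m_i · (bb r z (i + 1) - bb r z 1)`: TRACE-ZERO elements (each
`b_{i+1} - b_1` has trace `(-1) - (-1) = 0`); for `|m_i| ≤ M²`, `m_0 = 0` these parametrise a
sub-box of the square-difference-free set `A_K(M²) ⊂ Λ⁰_K`.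
[cite: Pohoata2026SharpExponentMinimalDistance, §3 (22)–(23) and Prop. 3.2] -/
def aa (r d : ℕ) (z : S) (m : Fin d → ℤ) : S := ∑ i, (m i : S) * (bb r z (i.1 + 1) - bb r z 1)

/-- `DD r d z m n m' n' = (a' - a) + (y' - y)²` with `a = aa r d z m`, `y = yy r d z n`, etc.:
the incidence defect `D(p, p')` of the point `p' = (a' + y'², y')` against the line of normal
`(1, -2y)` through `p = (a + y², y)` (`p' ∈ L_p ↔ D = 0`).
[cite: Pohoata2026SharpExponentMinimalDistance, (8)–(9) and (28)] -/
def DD (r d : ℕ) (z : S) (m n m' n' : Fin d → ℤ) : S :=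
  (aa r d z m' - aa r d z m) + (yy r d z n' - yy r d z n) ^ 2

section maps
variable {T : Type*} [CommRing T] {Φ : Type*} [FunLike Φ S T] [RingHomClass Φ S T] (f : Φ)
  (r d : ℕ) (z : S)

/-- `bb` is natural under ring homomorphisms. [folklore] -/
theorem map_bb (i : ℕ) : f (bb r z i) = bb r (f z) i := by simp [bb]

/-- `yy` is natural under ring homomorphisms. [folklore] -/
theorem map_yy (ν : Fin d → ℤ) : f (yy r d z ν) = yy r d (f z) ν := by
  simp [yy, map_sum, map_bb]

/-- `aa` is natural under ring homomorphisms. [folklore] -/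
theorem map_aa (m : Fin d → ℤ) : f (aa r d z m) = aa r d (f z) m := by
  simp [aa, map_sum, map_bb]

/-- `DD` is natural under ring homomorphisms (conjugation `σ_j`, the embedding into `ℂ`, and
reduction modulo `𝔮` all act through this). [folklore] -/
theorem map_DD (m n m' n' : Fin d → ℤ) :
    f (DD r d z m n m' n') = DD r d (f z) m n m' n' := by
  simp [DD, map_aa, map_yy]

end maps

section algebra
variable (r : ℕ) {d : ℕ} (z : S)

/-- `yy` is additive in the integer parameter. [folklore] -/
theorem yy_sub (ν ν' : Fin d → ℤ) : yy r d z (ν - ν') = yy r d z ν - yy r d z ν' := by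
  simp [yy, ← Finset.sum_sub_distrib, sub_mul]

/-- `yy` of a coordinate vector at `0` is a multiple of `bb r z 1`. [folklore] -/
theorem yy_single [NeZero d] (c : ℤ) : yy r d z (Pi.single 0 c) = (c : S) * bb r z 1 := by
  simp only [yy, Pi.single_apply, Int.cast_ite, Int.cast_zero, ite_mul, zero_mul,
    Finset.sum_ite_eq', Finset.mem_univ, if_true, Fin.val_zero]

/-- The reparametrisation `m ↦ m - (∑ m_i) e_0` with `aa z m = yy z (trz m)`.
[cite: Pohoata2026SharpExponentMinimalDistance, §3 (22)] -/
def trz [NeZero d] (m : Fin d → ℤ) : Fin d → ℤ := m - Pi.single 0 (∑ i, m i)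

/-- A trace-zero element is a `yy` of the reparametrised vector. [folklore] -/
theorem aa_eq_yy_trz [NeZero d] (m : Fin d → ℤ) : aa r d z m = yy r d z (trz m) := by
  rw [trz, yy_sub, yy_single, aa, yy, Int.cast_sum, Finset.sum_mul, ← Finset.sum_sub_distrib]
  exact Finset.sum_congr rfl fun i _ => by ring

/-- The reparametrisation is injective on vectors with vanishing `0`-th coordinate. [folklore] -/
theorem trz_injective [NeZero d] {m m' : Fin d → ℤ} (hm : m 0 = 0) (hm' : m' 0 = 0)
    (h : trz m = trz m') : m = m' := by
  funext i
  by_cases hi : i = 0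
  · subst hi; rw [hm, hm']
  · have := congrFun h i
    simpa [trz, Pi.single_apply, hi] using this

/-- inverse pairs give the same `bb` (for exponents `i ≤ r`). [folklore] -/
theorem bb_eq_of_mul_eq_one {w w' : S} (hw : w ^ r = 1) (hww' : w * w' = 1) {i : ℕ} (hi : i ≤ r) :
    bb r w' i = bb r w i := by
  have hw' : w' ^ r = 1 := by
    calc w' ^ r = w ^ r * w' ^ r := by rw [hw, one_mul]
      _ = 1 := by rw [← mul_pow, hww', one_pow]
  have h1 : w' ^ i = w ^ (r - i) := by
    apply left_inv_eq_right_inv (a := w ^ i)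
    · rw [← mul_pow, mul_comm, hww', one_pow]
    · rw [← pow_add, Nat.add_sub_cancel' hi, hw]
  have h2 : w' ^ (r - i) = w ^ i := by
    apply left_inv_eq_right_inv (a := w' ^ i)
    · rw [← pow_add, Nat.sub_add_cancel hi, hw']
    · rw [← mul_pow, mul_comm, hww', one_pow]
  rw [bb, bb, h1, h2, add_comm]

/-- `bb r (z ^ a) b = bb r (z ^ b) a` when `z ^ r = 1`. [folklore] -/
theorem bb_pow_swap (hz : z ^ r = 1) {a b : ℕ} (ha : a ≤ r) (hb : b ≤ r) :
    bb r (z ^ a) b = bb r (z ^ b) a := by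
  have key : (z ^ a) ^ (r - b) = (z ^ b) ^ (r - a) := by
    apply left_inv_eq_right_inv (a := z ^ (a * b))
    · rw [← pow_mul, ← pow_add, ← Nat.mul_add, Nat.sub_add_cancel hb, mul_comm a r, pow_mul, hz,
        one_pow]
    · rw [← pow_mul, ← pow_add, mul_comm a b, ← Nat.mul_add, Nat.add_sub_cancel' ha, mul_comm b r,
        pow_mul, hz, one_pow]
  simp only [bb, key, ← pow_mul, mul_comm a b]

/-- `bb r (z ^ (r - k)) i = bb r (z ^ k) i` when `z ^ r = 1`, `k ≤ r`, `i ≤ r`. [folklore] -/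
theorem bb_pow_sub (hz : z ^ r = 1) {k i : ℕ} (hk : k ≤ r) (hi : i ≤ r) :
    bb r (z ^ (r - k)) i = bb r (z ^ k) i := by
  apply bb_eq_of_mul_eq_one r
  · rw [← pow_mul, mul_comm, pow_mul, hz, one_pow]
  · rw [← pow_add, Nat.add_sub_cancel' hk, hz]
  · exact hi

/-- `z ^ k` only depends on `k % r` when `z ^ r = 1`. [folklore] -/
theorem pow_eq_pow_mod (hz : z ^ r = 1) (k : ℕ) : z ^ k = z ^ (k % r) := by
  conv_lhs => rw [← Nat.mod_add_div k r, pow_add, pow_mul, hz, one_pow, mul_one]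

/-- `bb r z 0 = 2` when `z ^ r = 1`. [folklore] -/
theorem bb_zero_right (hz : z ^ r = 1) : bb r z 0 = 2 := by
  rw [bb, pow_zero, Nat.sub_zero, hz]; norm_num

/-- product formula `bb a * bb b = bb (a + b) + bb (a - b)` for `b ≤ a`, `a + b ≤ r`. [folklore] -/
theorem bb_mul_bb (hz : z ^ r = 1) {a b : ℕ} (hba : b ≤ a) (hab : a + b ≤ r) :
    bb r z a * bb r z b = bb r z (a + b) + bb r z (a - b) := by
  obtain ⟨c, rfl⟩ := Nat.exists_eq_add_of_le hba
  obtain ⟨e, he⟩ := Nat.exists_eq_add_of_le hab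
  simp only [bb]
  have h1 : r - (b + c) = b + e := by omega
  have h2 : r - b = b + c + e := by omega
  have h3 : r - (b + c + b) = e := by omega
  have h4 : b + c - b = c := by omega
  have h5 : r - c = b + b + e := by omega
  rw [h1, h2, h3, h4, h5]
  have hz' : z ^ (b + b + c + e) = 1 := by rw [← hz, he]; ring_nf
  linear_combination (z ^ c + z ^ e) * hz'


/-- `DD` only depends on `z` through `bb r z i`, `i ≤ r`. [folklore] -/
theorem DD_congr {z z' : S} (hdr : d ≤ r) (h1r : 1 ≤ r) (h : ∀ i, i ≤ r → bb r z i = bb r z' i)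
    (m n m' n' : Fin d → ℤ) : DD r d z m n m' n' = DD r d z' m n m' n' := by
  have hy : ∀ ν, yy r d z ν = yy r d z' ν := fun ν =>
    Finset.sum_congr rfl fun i _ => by rw [h _ (by omega)]
  have ha : ∀ μ, aa r d z μ = aa r d z' μ := fun μ =>
    Finset.sum_congr rfl fun i _ => by rw [h _ (by omega), h 1 h1r]
  simp only [DD, hy, ha]

/-- `DD` at `z^{r-t}` equals `DD` at `z^t` (complex conjugation fixes the real subfield). [folklore] -/
theorem DD_pow_sub (hz : z ^ r = 1) (hdr : d ≤ r) (h1r : 1 ≤ r) {t : ℕ} (ht : t ≤ r)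
    (m n m' n' : Fin d → ℤ) : DD r d (z ^ (r - t)) m n m' n' = DD r d (z ^ t) m n m' n' :=
  DD_congr r hdr h1r (fun _ hi => bb_pow_sub r z hz ht hi) m n m' n'

/-- Folding an exponent into `{1, …, d}` (a transversal of `±` on `(ℤ/r)ˣ`, `r = 2d + 1`).
[folklore] -/
def fold (r d t : ℕ) : ℕ := if t % r ≤ d then t % r else r - t % r

/-- `fold` lands in `{1, …, d}` off the multiples of `r`. [folklore] -/
theorem fold_spec (hrd : r = 2 * d + 1) {t : ℕ} (ht : ¬ r ∣ t) :
    1 ≤ fold r d t ∧ fold r d t ≤ d := by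
  have h0 : t % r ≠ 0 := fun h => ht (Nat.dvd_of_mod_eq_zero h)
  have h1 : t % r < r := Nat.mod_lt _ (by omega)
  unfold fold
  split_ifs with h <;> omega

/-- `DD` at `z^t` only depends on the folded exponent. [folklore] -/
theorem DD_pow_fold (hz : z ^ r = 1) (hrd : r = 2 * d + 1) (t : ℕ) (m n m' n' : Fin d → ℤ) :
    DD r d (z ^ fold r d t) m n m' n' = DD r d (z ^ t) m n m' n' := by
  unfold fold
  split_ifs with h
  · rw [← pow_eq_pow_mod r z hz]
  · rw [DD_pow_sub r z hz (by omega) (by omega) (Nat.mod_lt _ (by omega)).le, ← pow_eq_pow_mod r z hz]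

/-- Multiplication by a unit followed by folding is injective on `{1, …, d}`. [folklore] -/
theorem fold_mul_inj (hrd : r = 2 * d + 1) {k : ℕ} (hk : k.Coprime r) {a b : ℕ} (ha1 : 1 ≤ a)
    (had : a ≤ d) (hb1 : 1 ≤ b) (hbd : b ≤ d) (h : fold r d (k * a) = fold r d (k * b)) :
    a = b := by
  have hlt1 : k * a % r < r := Nat.mod_lt _ (by omega)
  have hlt2 : k * b % r < r := Nat.mod_lt _ (by omega)
  have hcases : k * a % r = k * b % r ∨ k * a % r + k * b % r = r := by
    unfold fold at h
    split_ifs at h <;> omega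
  rcases hcases with h1 | h1
  · have hab : a ≡ b [MOD r] :=
      Nat.ModEq.cancel_left_of_coprime (by simpa [Nat.coprime_comm] using hk) h1
    rw [Nat.ModEq, Nat.mod_eq_of_lt (by omega), Nat.mod_eq_of_lt (by omega)] at hab
    exact hab
  · exfalso
    have hdvd : r ∣ k * (a + b) := by
      rw [Nat.dvd_iff_mod_eq_zero, mul_add, Nat.add_mod, h1, Nat.mod_self]
    have := Nat.le_of_dvd (by omega) (Nat.Coprime.dvd_of_dvd_mul_left hk.symm hdvd)
    omega

/-- Multiplying the indices `1, …, d` by a unit `k` permutes them after folding. [folklore] -/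
theorem prod_fold_perm (hrd : r = 2 * d + 1) {k : ℕ} (hk : k.Coprime r) {M : Type*} [CommMonoid M]
    (g : ℕ → M) (hg : ∀ t, g (fold r d t) = g t) :
    ∏ j : Fin d, g (k * (j.1 + 1)) = ∏ j : Fin d, g (j.1 + 1) := by
  have hnd : ∀ j : Fin d, ¬ r ∣ k * (j.1 + 1) := fun j h => by
    have := Nat.le_of_dvd (by omega) (Nat.Coprime.dvd_of_dvd_mul_left hk.symm h)
    omega
  let π : Fin d → Fin d := fun j =>
    ⟨fold r d (k * (j.1 + 1)) - 1, by have := fold_spec r hrd (hnd j); omega⟩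
  have hπ : Function.Injective π := by
    intro a b hab
    have h' : fold r d (k * (a.1 + 1)) - 1 = fold r d (k * (b.1 + 1)) - 1 := congrArg Fin.val hab
    have h1 := (fold_spec r hrd (hnd a)).1
    have h2 := (fold_spec r hrd (hnd b)).1
    have h3 : fold r d (k * (a.1 + 1)) = fold r d (k * (b.1 + 1)) := by omega
    have := fold_mul_inj r hrd hk (by omega) (by omega) (by omega) (by omega) h3
    exact Fin.ext (by omega)
  calc ∏ j : Fin d, g (k * (j.1 + 1)) = ∏ j : Fin d, g ((π j).1 + 1) :=
        Finset.prod_congr rfl fun j _ => by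
          rw [Nat.sub_add_cancel (fold_spec r hrd (hnd j)).1, hg]
    _ = ∏ j : Fin d, g (j.1 + 1) := hπ.bijective_of_finite.prod_comp fun j : Fin d => g (j.1 + 1)

end algebra

section complexSide
open Complex
open scoped ComplexConjugate

variable (r d : ℕ)

/-- `‖bb r w i‖ ≤ 2` on the unit circle. [folklore] -/
theorem norm_bb_le {w : ℂ} (hw : ‖w‖ = 1) (i : ℕ) : ‖bb r w i‖ ≤ 2 := by
  unfold bb
  calc ‖w ^ i + w ^ (r - i)‖ ≤ ‖w ^ i‖ + ‖w ^ (r - i)‖ := norm_add_le _ _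
    _ = 2 := by rw [norm_pow, norm_pow, hw, one_pow, one_pow]; norm_num

/-- `‖yy‖ ≤ 2 ∑ |ν_i|` on the unit circle. [folklore] -/
theorem norm_yy_le {w : ℂ} (hw : ‖w‖ = 1) (ν : Fin d → ℤ) :
    ‖yy r d w ν‖ ≤ 2 * ∑ i, |(ν i : ℝ)| := by
  unfold yy
  calc ‖∑ i, (ν i : ℂ) * bb r w (i.1 + 1)‖ ≤ ∑ i, ‖(ν i : ℂ) * bb r w (i.1 + 1)‖ := norm_sum_le _ _
    _ ≤ ∑ i, |(ν i : ℝ)| * 2 := Finset.sum_le_sum fun i _ => by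
        rw [norm_mul, Complex.norm_intCast]
        exact mul_le_mul_of_nonneg_left (norm_bb_le r hw _) (abs_nonneg _)
    _ = 2 * ∑ i, |(ν i : ℝ)| := by rw [Finset.mul_sum]; exact Finset.sum_congr rfl fun i _ => by ring

/-- `‖aa‖ ≤ 4 ∑ |m_i|` on the unit circle. [folklore] -/
theorem norm_aa_le {w : ℂ} (hw : ‖w‖ = 1) (m : Fin d → ℤ) :
    ‖aa r d w m‖ ≤ 4 * ∑ i, |(m i : ℝ)| := by
  unfold aa
  calc ‖∑ i, (m i : ℂ) * (bb r w (i.1 + 1) - bb r w 1)‖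
        ≤ ∑ i, ‖(m i : ℂ) * (bb r w (i.1 + 1) - bb r w 1)‖ := norm_sum_le _ _
    _ ≤ ∑ i, |(m i : ℝ)| * 4 := Finset.sum_le_sum fun i _ => by
        rw [norm_mul, Complex.norm_intCast]
        refine mul_le_mul_of_nonneg_left ?_ (abs_nonneg _)
        calc ‖bb r w (i.1 + 1) - bb r w 1‖ ≤ ‖bb r w (i.1 + 1)‖ + ‖bb r w 1‖ := norm_sub_le _ _
          _ ≤ 2 + 2 := add_le_add (norm_bb_le r hw _) (norm_bb_le r hw _)
          _ = 4 := by norm_num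
    _ = 4 * ∑ i, |(m i : ℝ)| := by rw [Finset.mul_sum]; exact Finset.sum_congr rfl fun i _ => by ring

/-- The archimedean bound `|ρ(D(p,p'))| ≤ H` (paper, display before (33)).
[cite: Pohoata2026SharpExponentMinimalDistance, (30)/(33)] -/
theorem norm_DD_le {w : ℂ} (hw : ‖w‖ = 1) (m n m' n' : Fin d → ℤ) {A B : ℝ}
    (hm : ∑ i, |(m i : ℝ)| ≤ A) (hm' : ∑ i, |(m' i : ℝ)| ≤ A)
    (hn : ∑ i, |(n i : ℝ)| ≤ B) (hn' : ∑ i, |(n' i : ℝ)| ≤ B) :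
    ‖DD r d w m n m' n'‖ ≤ 8 * A + 16 * B ^ 2 := by
  have hB : 0 ≤ B := le_trans (Finset.sum_nonneg fun i _ => abs_nonneg _) hn
  have h1 : ‖aa r d w m' - aa r d w m‖ ≤ 4 * A + 4 * A :=
    (norm_sub_le _ _).trans (add_le_add ((norm_aa_le r d hw m').trans (by linarith))
      ((norm_aa_le r d hw m).trans (by linarith)))
  have h2 : ‖yy r d w n' - yy r d w n‖ ≤ 2 * B + 2 * B :=
    (norm_sub_le _ _).trans (add_le_add ((norm_yy_le r d hw n').trans (by linarith))
      ((norm_yy_le r d hw n).trans (by linarith)))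
  unfold DD
  calc ‖aa r d w m' - aa r d w m + (yy r d w n' - yy r d w n) ^ 2‖
        ≤ ‖aa r d w m' - aa r d w m‖ + ‖(yy r d w n' - yy r d w n) ^ 2‖ := norm_add_le _ _
    _ ≤ (4 * A + 4 * A) + (2 * B + 2 * B) ^ 2 := by
        rw [norm_pow]
        exact add_le_add h1 (pow_le_pow_left₀ (norm_nonneg _) h2 2)
    _ = 8 * A + 16 * B ^ 2 := by ring

/-- reality: `bb r w i` is fixed by complex conjugation when `w ^ r = 1`, `i ≤ r`.
[cite: Pohoata2026SharpExponentMinimalDistance, Obs. 3.1] -/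
theorem conj_bb {w : ℂ} (hr : r ≠ 0) (hw : w ^ r = 1) {i : ℕ} (hi : i ≤ r) :
    conj (bb r w i) = bb r w i := by
  have hw1 : ‖w‖ = 1 := Complex.norm_eq_one_of_pow_eq_one hw hr
  have hw0 : w ≠ 0 := by rintro rfl; simp at hw1
  rw [show conj (bb r w i) = bb r (conj w) i from map_bb (starRingEnd ℂ) r w i,
    ← Complex.inv_eq_conj hw1]
  exact bb_eq_of_mul_eq_one r hw (mul_inv_cancel₀ hw0) hi

/-- `yy` is real on `r`-th roots of unity. [folklore] -/
theorem conj_yy {w : ℂ} (hr : r ≠ 0) (hw : w ^ r = 1) (hdr : d ≤ r) (ν : Fin d → ℤ) :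
    conj (yy r d w ν) = yy r d w ν := by
  unfold yy
  rw [map_sum]
  refine Finset.sum_congr rfl fun i _ => ?_
  rw [map_mul, map_intCast, conj_bb r hr hw (by omega)]

/-- `yy` equals (the cast of) its real part on `r`-th roots of unity. [folklore] -/
theorem yy_eq_re {w : ℂ} (hr : r ≠ 0) (hw : w ^ r = 1) (hdr : d ≤ r) (ν : Fin d → ℤ) :
    yy r d w ν = ((yy r d w ν).re : ℂ) :=
  (conj_eq_iff_re.mp (conj_yy r d hr hw hdr ν)).symm

/-- `∑_{x<r} w^x = 0` for `w ≠ 1`, `w ^ r = 1`. [folklore] -/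
theorem geom_sum_eq_zero_of_pow_eq_one {w : ℂ} (hw : w ^ r = 1) (hw1 : w ≠ 1) :
    ∑ x ∈ range r, w ^ x = 0 := by
  have := geom_sum_mul w r
  rw [hw, sub_self] at this
  exact (mul_eq_zero.mp this).resolve_right (sub_ne_zero.mpr hw1)

/-- `∑_{j=1}^{d} (w^j + w^{r-j}) = ∑_{j=1}^{r-1} w^j = -1` for `w ≠ 1`, `w^r = 1`, `r = 2d+1`. [folklore] -/
theorem sum_bb_aux {w : ℂ} (hrd : r = 2 * d + 1) (hw : w ^ r = 1) (hw1 : w ≠ 1) :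
    ∑ j ∈ range d, bb r w (j + 1) = -1 := by
  have h1 : ∑ j ∈ range d, bb r w (j + 1)
      = ∑ j ∈ range d, w ^ (j + 1) + ∑ j ∈ range d, w ^ (d + 1 + j) := by
    simp only [bb, sum_add_distrib]
    congr 1
    rw [← sum_range_reflect (fun j => w ^ (d + 1 + j)) d]
    refine sum_congr rfl fun j hj => ?_
    rw [mem_range] at hj
    congr 1
    omega
  have h2 : ∑ j ∈ range d, w ^ (j + 1) + ∑ j ∈ range d, w ^ (d + 1 + j)
      = ∑ j ∈ range (d + d), w ^ (j + 1) := by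
    rw [sum_range_add]
    congr 1
    refine sum_congr rfl fun j _ => ?_
    ring_nf
  have h3 : ∑ j ∈ range r, w ^ j = (∑ j ∈ range (d + d), w ^ (j + 1)) + 1 := by
    rw [hrd, two_mul, Finset.sum_range_succ', pow_zero]
  rw [h1, h2]
  have := geom_sum_eq_zero_of_pow_eq_one r hw hw1
  rw [h3] at this
  linear_combination this

/-- The trace identity `∑_{j=1}^{d} (ω^{jt} + ω^{-jt}) = -1` for `r ∤ t` (paper, Obs. 3.1 /
proof of Prop. 3.2: `Tr_{K/ℚ}`).
[cite: Pohoata2026SharpExponentMinimalDistance, Obs. 3.1 / Prop. 3.2] -/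
theorem sum_bb {ω : ℂ} (hω : IsPrimitiveRoot ω r) (hrd : r = 2 * d + 1) {t : ℕ} (ht : ¬ r ∣ t)
    (htr : t ≤ r) : ∑ j ∈ range d, bb r (ω ^ (j + 1)) t = -1 := by
  have hωr := hω.pow_eq_one
  calc ∑ j ∈ range d, bb r (ω ^ (j + 1)) t = ∑ j ∈ range d, bb r (ω ^ t) (j + 1) := by
        refine sum_congr rfl fun j hj => ?_
        rw [mem_range] at hj
        exact bb_pow_swap r ω hωr (by omega) htr
    _ = -1 := sum_bb_aux r d hrd (by rw [← pow_mul, mul_comm, pow_mul, hωr, one_pow])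
            (by rwa [Ne, hω.pow_eq_one_iff_dvd])

/-- `sum_bb` indexed by `Fin d`. [folklore] -/
theorem sum_bb_fin {ω : ℂ} (hω : IsPrimitiveRoot ω r) (hrd : r = 2 * d + 1) {t : ℕ} (ht : ¬ r ∣ t)
    (htr : t ≤ r) : ∑ j : Fin d, bb r (ω ^ (j.1 + 1)) t = -1 := by
  rw [Fin.sum_univ_eq_sum_range (fun j => bb r (ω ^ (j + 1)) t) d]
  exact sum_bb r d hω hrd ht htr

/-- Gram matrix of the `bb`'s under the trace form: `r - 2` on the diagonal, `-2` off it.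
[cite: Pohoata2026SharpExponentMinimalDistance, Prop. 3.2 (rank of `Λ⁰_K`)] -/
theorem gram {ω : ℂ} (hω : IsPrimitiveRoot ω r) (hrd : r = 2 * d + 1) (i k : Fin d) :
    ∑ j : Fin d, bb r (ω ^ (j.1 + 1)) (i.1 + 1) * bb r (ω ^ (j.1 + 1)) (k.1 + 1)
      = if i = k then (r : ℂ) - 2 else -2 := by
  wlog hki : k.1 ≤ i.1 generalizing i k
  · have := this k i (le_of_not_ge hki)
    rw [show (∑ j : Fin d, bb r (ω ^ (j.1 + 1)) (i.1 + 1) * bb r (ω ^ (j.1 + 1)) (k.1 + 1))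
        = ∑ j : Fin d, bb r (ω ^ (j.1 + 1)) (k.1 + 1) * bb r (ω ^ (j.1 + 1)) (i.1 + 1) from
      Finset.sum_congr rfl fun j _ => mul_comm _ _, this]
    rcases eq_or_ne i k with rfl | hne
    · simp
    · simp [hne, hne.symm]
  have hpow : ∀ j : Fin d, (ω ^ (j.1 + 1)) ^ r = 1 := fun j => by
    rw [← pow_mul, mul_comm, pow_mul, hω.pow_eq_one, one_pow]
  have hprod : ∀ j : Fin d, bb r (ω ^ (j.1 + 1)) (i.1 + 1) * bb r (ω ^ (j.1 + 1)) (k.1 + 1)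
      = bb r (ω ^ (j.1 + 1)) (i.1 + 1 + (k.1 + 1)) + bb r (ω ^ (j.1 + 1)) (i.1 + 1 - (k.1 + 1)) :=
    fun j => bb_mul_bb r (ω ^ (j.1 + 1)) (hpow j) (by omega) (by omega)
  simp_rw [hprod, sum_add_distrib]
  rw [sum_bb_fin r d hω hrd (t := i.1 + 1 + (k.1 + 1))
      (fun h => by have := Nat.le_of_dvd (by omega) h; omega) (by omega)]
  split_ifs with hik
  · subst hik
    simp only [Nat.sub_self]
    rw [Finset.sum_congr rfl fun j _ => bb_zero_right r _ (hpow j)]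
    simp only [sum_const, card_univ, Fintype.card_fin, nsmul_eq_mul, hrd]
    push_cast
    ring
  · have hne : i.1 ≠ k.1 := fun h => hik (Fin.ext h)
    rw [sum_bb_fin r d hω hrd (t := i.1 + 1 - (k.1 + 1))
      (fun h => by have := Nat.le_of_dvd (by omega) h; omega) (by omega)]
    norm_num

/-- Linear independence of `bb_1, …, bb_d` seen through the trace pairing: if all conjugates of
`∑ ν_i bb_{i+1}` vanish then `ν = 0`. [cite: Pohoata2026SharpExponentMinimalDistance, Prop. 3.2] -/
theorem indep {ω : ℂ} (hω : IsPrimitiveRoot ω r) (hrd : r = 2 * d + 1) (ν : Fin d → ℤ)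
    (h : ∀ j : Fin d, yy r d (ω ^ (j.1 + 1)) ν = 0) : ν = 0 := by
  have step : ∀ k : Fin d, (r : ℤ) * ν k = 2 * ∑ i, ν i := by
    intro k
    have h0 : ∑ j : Fin d, yy r d (ω ^ (j.1 + 1)) ν * bb r (ω ^ (j.1 + 1)) (k.1 + 1) = 0 := by
      simp [h]
    have h1 : ∑ j : Fin d, yy r d (ω ^ (j.1 + 1)) ν * bb r (ω ^ (j.1 + 1)) (k.1 + 1)
        = ∑ i : Fin d, (ν i : ℂ) *
            ∑ j : Fin d, bb r (ω ^ (j.1 + 1)) (i.1 + 1) * bb r (ω ^ (j.1 + 1)) (k.1 + 1) := by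
      simp only [yy, Finset.sum_mul, Finset.mul_sum, mul_assoc]
      rw [Finset.sum_comm]
    have h2 : ∀ i : Fin d, (ν i : ℂ) * (if i = k then ((r : ℂ) - 2) else -2)
        = (if i = k then (r : ℂ) * ν i else 0) - 2 * ν i := by
      intro i
      split_ifs <;> ring
    rw [h1] at h0
    simp_rw [gram r d hω hrd, h2, Finset.sum_sub_distrib, Finset.sum_ite_eq', Finset.mem_univ,
      if_true, ← Finset.mul_sum] at h0
    exact_mod_cast sub_eq_zero.mp h0
  have hsum : ∑ i, ν i = 0 := by
    have h3 : ∑ k : Fin d, (r : ℤ) * ν k = ∑ k : Fin d, 2 * ∑ i, ν i :=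
      Finset.sum_congr rfl fun k _ => step k
    rw [← Finset.mul_sum, Finset.sum_const, Finset.card_univ, Fintype.card_fin, nsmul_eq_mul,
      hrd] at h3
    push_cast at h3
    linarith
  funext k
  have := step k
  rw [hsum, mul_zero] at this
  have hr0 : (r : ℤ) ≠ 0 := by omega
  exact (mul_eq_zero.mp this).resolve_left hr0

/-- **Claim A** (= paper (29): off-diagonal `D(p,p') ≠ 0`, via the trace-zero trick of Prop. 3.2):
if every conjugate of `DD` vanishes then the two parameter pairs coincide.
[cite: Pohoata2026SharpExponentMinimalDistance, (29) and Prop. 3.2] -/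
theorem claimA [NeZero d] {ω : ℂ} (hω : IsPrimitiveRoot ω r) (hrd : r = 2 * d + 1)
    {m n m' n' : Fin d → ℤ} (hm : m 0 = 0) (hm' : m' 0 = 0)
    (h : ∀ j : Fin d, DD r d (ω ^ (j.1 + 1)) m n m' n' = 0) : m = m' ∧ n = n' := by
  have hr0 : r ≠ 0 := by omega
  have hd : 0 < d := Nat.pos_of_ne_zero (NeZero.ne d)
  have hωr := hω.pow_eq_one
  have hpow : ∀ j : Fin d, (ω ^ (j.1 + 1)) ^ r = 1 := fun j => by
    rw [← pow_mul, mul_comm, pow_mul, hωr, one_pow]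
  -- the trace of a trace-zero element vanishes
  have haa : ∀ μ : Fin d → ℤ, ∑ j : Fin d, aa r d (ω ^ (j.1 + 1)) μ = 0 := by
    intro μ
    simp only [aa]
    rw [Finset.sum_comm]
    refine Finset.sum_eq_zero fun i _ => ?_
    rw [← Finset.mul_sum, Finset.sum_sub_distrib,
      sum_bb_fin r d hω hrd (t := i.1 + 1) (fun h => by have := Nat.le_of_dvd (by omega) h; omega)
        (by omega),
      sum_bb_fin r d hω hrd (t := 1) (fun h => by have := Nat.le_of_dvd (by omega) h; omega)
        (by omega),
      sub_self, mul_zero]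
  -- real parts of the conjugates of `y' - y`
  set Y : Fin d → ℝ := fun j => (yy r d (ω ^ (j.1 + 1)) (n' - n)).re with hY
  have hYc : ∀ j : Fin d, yy r d (ω ^ (j.1 + 1)) n' - yy r d (ω ^ (j.1 + 1)) n = (Y j : ℂ) := by
    intro j
    rw [← yy_sub, hY]
    exact yy_eq_re r d hr0 (hpow j) (by omega) _
  have hY0 : ∑ j : Fin d, (Y j) ^ 2 = 0 := by
    have hs : ∑ j : Fin d, DD r d (ω ^ (j.1 + 1)) m n m' n' = 0 := Finset.sum_eq_zero fun j _ => h j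
    simp only [DD, Finset.sum_add_distrib, Finset.sum_sub_distrib, haa, sub_self, zero_add, hYc] at hs
    exact_mod_cast hs
  have hYj : ∀ j, Y j = 0 := fun j =>
    pow_eq_zero_iff (n := 2) two_ne_zero |>.mp
      ((Finset.sum_eq_zero_iff_of_nonneg fun j _ => sq_nonneg (Y j)).mp hY0 j (Finset.mem_univ _))
  have hn : n' - n = 0 := by
    refine indep r d hω hrd _ fun j => ?_
    have h1 := hYc j
    rw [hYj j, ← yy_sub] at h1
    exact_mod_cast h1
  have hn' : n = n' := (sub_eq_zero.mp hn).symm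
  refine ⟨?_, hn'⟩
  have haa' : ∀ j : Fin d, yy r d (ω ^ (j.1 + 1)) (trz m' - trz m) = 0 := by
    intro j
    have := h j
    rwa [DD, hn', sub_self, zero_pow two_ne_zero, add_zero, aa_eq_yy_trz, aa_eq_yy_trz,
      ← yy_sub] at this
  have := indep r d hω hrd _ haa'
  exact trz_injective hm hm' (sub_eq_zero.mp this).symm

end complexSide

section numberField
open Polynomial IsCyclotomicExtension

variable (r d : ℕ)

/-- In a finite Galois extension of `ℚ`, an algebraic integer fixed by every automorphism is a
rational integer. [folklore] -/
theorem exists_int_of_fixed {L : Type*} [Field L] [NumberField L] [IsGalois ℚ L]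
    (x : L) (hint : IsIntegral ℤ x) (hfix : ∀ f : L ≃ₐ[ℚ] L, f x = x) : ∃ N : ℤ, (N : L) = x := by
  obtain ⟨ρ, hρ⟩ := (IsGalois.mem_range_algebraMap_iff_fixed x).mpr hfix
  rw [← hρ] at hint
  obtain ⟨N, hN⟩ := IsIntegrallyClosed.algebraMap_eq_of_integral
    ((isIntegral_algebraMap_iff (algebraMap ℚ L).injective).mp hint)
  refine ⟨N, ?_⟩
  rw [← hρ, ← hN]
  simp

/-- **Proposition 5.1 of the paper (the reduction step), in coordinates.**  With
`K ⊂ L = ℚ(ζ_r)`, `D = DD(ζ)`, and `H^d < q`: if the reduction `DD(η)` of `D` modulo the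
degree-one prime `(q, ζ + ζ⁻¹ - (η + η⁻¹))` vanished, then `q` would divide the nonzero rational
integer `N_{K/ℚ}(D) = ∏_{j=1}^{d} σ_j(D)`, whose absolute value is at most `H^d < q`.
[cite: Pohoata2026SharpExponentMinimalDistance, Prop. 5.1] -/
theorem DD_ne_zero_of_reduction (L : Type*) [Field L] [NumberField L] [NeZero r]
    [IsCyclotomicExtension {r} ℚ L] (hr : r.Prime) (hrd : r = 2 * d + 1) [NeZero d]
    {q : ℕ} {F : Type*} [Field F] [CharP F q] {η : F} (hη : IsPrimitiveRoot η r)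
    [NeZero (r : F)] {H : ℕ} (hHq : H ^ d < q)
    {m n m' n' : Fin d → ℤ} (hm : m 0 = 0) (hm' : m' 0 = 0)
    (hbound : ∀ w : ℂ, ‖w‖ = 1 → w ^ r = 1 → ‖DD r d w m n m' n'‖ ≤ H)
    (hne : ¬ (m = m' ∧ n = n')) : DD r d η m n m' n' ≠ 0 := by
  intro hD
  haveI := IsCyclotomicExtension.isGalois {r} ℚ L
  set ζ := zeta r ℚ L with hζdef
  have hζ : IsPrimitiveRoot ζ r := zeta_spec r ℚ L
  have hd : 0 < d := Nat.pos_of_ne_zero (NeZero.ne d)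
  have hr0 : 0 < r := by omega
  have hirr := cyclotomic.irreducible_rat hr0
  have hζint : IsIntegral ℤ ζ := hζ.isIntegral hr0
  have hζr := hζ.pow_eq_one
  -- the conjugates `σ_t(D)`
  set E : ℕ → L := fun t => DD r d (ζ ^ t) m n m' n' with hE
  have hσ : ∀ k : ℕ, k.Coprime r → ∃ σ : L ≃ₐ[ℚ] L, σ ζ = ζ ^ k := fun k hk =>
    ⟨fromZetaAut (hζ.pow_of_coprime k hk) hirr, fromZetaAut_spec _ _⟩
  have hEmap : ∀ (σ : L ≃ₐ[ℚ] L) (k : ℕ), σ ζ = ζ ^ k → ∀ t, σ (E t) = E (k * t) := by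
    intro σ k hk t
    simp only [hE]
    rw [map_DD, map_pow, hk, ← pow_mul]
  have hcop : ∀ j : Fin d, (j.1 + 1).Coprime r := fun j =>
    (Nat.coprime_of_lt_prime (by omega) (by have := j.2; omega) hr).symm
  -- Step 1: `D ≠ 0`, hence all its conjugates are nonzero (Claim A)
  have hE1 : E 1 ≠ 0 := by
    intro h1
    apply hne
    let ι : L →ₐ[ℚ] ℂ := IsAlgClosed.lift
    have hιinj : Function.Injective ι := ι.toRingHom.injective
    have hω : IsPrimitiveRoot (ι ζ) r := hζ.map_of_injective hιinj
    refine claimA r d hω hrd hm hm' fun j => ?_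
    obtain ⟨σ, hσk⟩ := hσ (j.1 + 1) (hcop j)
    have h2 := hEmap σ (j.1 + 1) hσk 1
    rw [mul_one, h1, map_zero] at h2
    have h3 : ι (E (j.1 + 1)) = DD r d (ι ζ ^ (j.1 + 1)) m n m' n' := by
      simp only [hE]
      rw [map_DD, map_pow]
    rw [← h3, ← h2, map_zero]
  have hEne : ∀ j : Fin d, E (j.1 + 1) ≠ 0 := by
    intro j hj
    obtain ⟨σ, hσk⟩ := hσ (j.1 + 1) (hcop j)
    have h2 := hEmap σ (j.1 + 1) hσk 1
    rw [mul_one, hj] at h2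
    exact hE1 ((map_eq_zero_iff σ σ.injective).mp h2)
  -- Step 2: the half norm `N_{K/ℚ}(D) = ∏_{j=1}^{d} σ_j(D)` is fixed by `Gal(L/ℚ)`
  set HN : L := ∏ j : Fin d, E (j.1 + 1) with hHN
  have hHN0 : HN ≠ 0 := Finset.prod_ne_zero_iff.mpr fun j _ => hEne j
  have hfold : ∀ t, E (fold r d t) = E t := fun t => DD_pow_fold r ζ hζr hrd t m n m' n'
  have hfix : ∀ f : L ≃ₐ[ℚ] L, f HN = HN := by
    intro f
    obtain ⟨k, -, hk⟩ := hζ.eq_pow_of_pow_eq_one (ξ := f ζ) (by rw [← map_pow, hζr, map_one])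
    have hkcop : k.Coprime r :=
      (hζ.pow_iff_coprime hr0 k).mp (hk ▸ hζ.map_of_injective f.injective)
    rw [hHN, map_prod]
    simp_rw [hEmap f k hk.symm]
    exact prod_fold_perm r hrd hkcop E hfold
  -- Step 3: it lies in `ℤ[ζ]`, hence is a rational integer `N`
  set R : Subalgebra ℤ L := Algebra.adjoin ℤ ({ζ} : Set L) with hR
  have hζmem : ζ ∈ R := Algebra.subset_adjoin (Set.mem_singleton ζ)
  set ζR : R := ⟨ζ, hζmem⟩ with hζR
  set ER : ℕ → R := fun t => DD r d (ζR ^ t) m n m' n' with hER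
  have hERE : ∀ t, (ER t : L) = E t := by
    intro t
    simp only [hER, hE]
    rw [← Subalgebra.coe_val, map_DD, map_pow, Subalgebra.coe_val]
  set HNR : R := ∏ j : Fin d, ER (j.1 + 1) with hHNR
  have hHNRc : (HNR : L) = HN := by
    simp only [hHNR, hHN]
    rw [← Subalgebra.coe_val, map_prod]
    simp only [Subalgebra.coe_val, hERE]
  have hint : IsIntegral ℤ HN :=
    IsIntegral.of_mem_of_fg R hζint.fg_adjoin_singleton HN (hHNRc ▸ HNR.2)
  obtain ⟨N, hN⟩ := exists_int_of_fixed HN hint hfix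
  have hN0 : N ≠ 0 := by
    rintro rfl
    exact hHN0 (by rw [← hN, Int.cast_zero])
  have hHNRN : HNR = (N : R) := Subtype.ext (by rw [hHNRc, ← hN]; rfl)
  -- Step 4: reduce modulo the prime above `q`: `ψ : ℤ[ζ] → F`, `ζ ↦ η`
  let pb := Algebra.adjoin.powerBasis' hζint
  have hgen : pb.gen = ζR := by
    rw [hζR, Algebra.adjoin.powerBasis'_gen]
  have hroot : aeval η (minpoly ℤ pb.gen) = 0 := by
    rw [← Algebra.adjoin.powerBasis'_minpoly_gen, ← cyclotomic_eq_minpoly hζ hr0,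
      aeval_def, eval₂_eq_eval_map, map_cyclotomic, ← IsRoot.def, isRoot_cyclotomic_iff]
    exact hη
  let ψ : R →ₐ[ℤ] F := pb.lift η hroot
  have hψζ : ψ ζR = η := by rw [← hgen]; exact pb.lift_gen η hroot
  have hψE : ∀ t, ψ (ER t) = DD r d (η ^ t) m n m' n' := by
    intro t
    simp only [hER]
    rw [map_DD, map_pow, hψζ]
  have hψHN : ψ HNR = 0 := by
    rw [hHNR, map_prod]
    refine Finset.prod_eq_zero (Finset.mem_univ (0 : Fin d)) ?_
    rw [hψE, Fin.val_zero, zero_add, pow_one, hD]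
  have hqN : (q : ℤ) ∣ N := by
    rw [← CharP.intCast_eq_zero_iff F q, ← map_intCast ψ, ← hHNRN]
    exact hψHN
  -- Step 5: the archimedean bound `|N| ≤ H ^ d`
  let ι : L →ₐ[ℚ] ℂ := IsAlgClosed.lift
  have hιinj : Function.Injective ι := ι.toRingHom.injective
  have hω : IsPrimitiveRoot (ι ζ) r := hζ.map_of_injective hιinj
  have hιHN : ι HN = ∏ j : Fin d, DD r d (ι ζ ^ (j.1 + 1)) m n m' n' := by
    rw [hHN, map_prod]
    refine Finset.prod_congr rfl fun j _ => ?_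
    simp only [hE]
    rw [map_DD, map_pow]
  have hNbound : (|N| : ℝ) ≤ (H : ℝ) ^ d := by
    have h1 : ‖ι HN‖ ≤ (H : ℝ) ^ d := by
      rw [hιHN, norm_prod]
      calc ∏ j : Fin d, ‖DD r d (ι ζ ^ (j.1 + 1)) m n m' n'‖ ≤ ∏ _j : Fin d, (H : ℝ) :=
            Finset.prod_le_prod (fun _ _ => norm_nonneg _) fun j _ =>
              hbound _ (by rw [norm_pow, hω.norm'_eq_one (by omega), one_pow])
                (by rw [← pow_mul, mul_comm, pow_mul, hω.pow_eq_one, one_pow])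
        _ = (H : ℝ) ^ d := by simp
    rwa [← hN, map_intCast, Complex.norm_intCast] at h1
  -- Step 6: `q ∣ N`, `N ≠ 0`, `|N| ≤ H ^ d < q`: contradiction
  have hqle : q ≤ N.natAbs := Nat.le_of_dvd (Int.natAbs_pos.mpr hN0) (Int.ofNat_dvd_left.mp hqN)
  have hle : (N.natAbs : ℝ) ≤ (H : ℝ) ^ d := by
    rw [Nat.cast_natAbs, Int.cast_abs]
    exact hNbound
  have : N.natAbs ≤ H ^ d := by exact_mod_cast hle
  omega

end numberField

section finiteField
open Polynomial

variable (q : ℕ) [Fact q.Prime] {F : Type*} [Field F] [Algebra (ZMod q) F]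

/-- Elements of a field of characteristic `q` fixed by Frobenius lie in the prime field
(`X^q - X` has at most `q` roots). [folklore] -/
theorem mem_range_algebraMap_of_pow_eq {x : F} (hx : x ^ q = x) :
    x ∈ Set.range (algebraMap (ZMod q) F) := by
  by_contra hxr
  have hq1 : 1 < q := (Fact.out : q.Prime).one_lt
  set P : F[X] := X ^ q - X with hP
  have hP0 : P ≠ 0 := FiniteField.X_pow_card_sub_X_ne_zero F hq1
  have hdeg : P.natDegree = q := FiniteField.X_pow_card_sub_X_natDegree_eq F hq1
  classical
  set T : Finset F := insert x ((Finset.univ : Finset (ZMod q)).image (algebraMap (ZMod q) F))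
    with hT
  have hxT : x ∉ (Finset.univ : Finset (ZMod q)).image (algebraMap (ZMod q) F) := by
    intro hx'
    obtain ⟨a, -, ha⟩ := Finset.mem_image.mp hx'
    exact hxr ⟨a, ha⟩
  have hTcard : T.card = q + 1 := by
    rw [hT, Finset.card_insert_of_notMem hxT,
      Finset.card_image_of_injective _ (algebraMap (ZMod q) F).injective, Finset.card_univ,
      ZMod.card]
  have hsub : T ⊆ P.roots.toFinset := by
    intro y hy
    rw [Multiset.mem_toFinset, mem_roots hP0, IsRoot.def, hP, eval_sub, eval_pow, eval_X,
      sub_eq_zero]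
    rcases Finset.mem_insert.mp hy with rfl | hy
    · exact hx
    · obtain ⟨a, -, rfl⟩ := Finset.mem_image.mp hy
      rw [← map_pow, ZMod.pow_card]
  have h1 := (Finset.card_le_card hsub).trans ((Multiset.toFinset_card_le _).trans (card_roots' P))
  rw [hTcard, hdeg] at h1
  omega

/-- For `q ≡ ±1 (mod r)` the real cyclotomic numbers `η^i + η^{-i}` (`i ≤ r`) lie in the prime
field `𝔽_q ⊂ F` (the prime `q` splits completely in `ℚ(ζ_r + ζ_r⁻¹)`; paper, §5, display
after the proof of Prop. 5.1). [cite: Pohoata2026SharpExponentMinimalDistance, §5] -/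
theorem bb_mem_range [CharP F q] (r : ℕ) {η : F} (hη : η ^ r = 1)
    (hq : q % r = 1 ∨ q % r = r - 1) (h1r : 1 ≤ r) {i : ℕ} (hi : i ≤ r) :
    bb r η i ∈ Set.range (algebraMap (ZMod q) F) := by
  apply mem_range_algebraMap_of_pow_eq q
  have hfrob : (bb r η i) ^ q = bb r (η ^ q) i := by
    rw [← frobenius_def, map_bb, frobenius_def]
  rw [hfrob, pow_eq_pow_mod r η hη q]
  rcases hq with h | h
  · rw [h, pow_one]
  · rw [h, bb_pow_sub r η hη h1r hi, pow_one]

end finiteField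

section counting

/-- The counting estimate behind `|A||Y| ≳ M^{3d-2}` (paper, proof of Prop. 5.1, last line).
[cite: Pohoata2026SharpExponentMinimalDistance, Prop. 5.1] -/
theorem count_bound (d : ℕ) (hd : 1 ≤ d) (x : ℝ) (hx : 0 ≤ x) (M : ℕ) (hM : x ≤ M + 1) :
    x ^ (3 * d - 2) / 2 ^ (d - 1) ≤ ((2 * M ^ 2 + 1) ^ (d - 1) * (2 * M + 1) ^ d : ℕ) := by
  have h1 : x ^ d ≤ (2 * M + 1 : ℝ) ^ d := pow_le_pow_left₀ hx (by linarith) d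
  have hx2 : x ^ 2 ≤ ((M : ℝ) + 1) ^ 2 := pow_le_pow_left₀ hx hM 2
  have h2 : (x ^ 2 / 2) ^ (d - 1) ≤ (2 * (M : ℝ) ^ 2 + 1) ^ (d - 1) :=
    pow_le_pow_left₀ (by positivity) (by nlinarith [sq_nonneg ((M : ℝ) - 1)]) (d - 1)
  have h3 : 3 * d - 2 = d + 2 * (d - 1) := by omega
  calc x ^ (3 * d - 2) / 2 ^ (d - 1) = x ^ d * (x ^ 2 / 2) ^ (d - 1) := by
        rw [h3, pow_add, pow_mul, div_pow]; ring
    _ ≤ (2 * M + 1 : ℝ) ^ d * (2 * (M : ℝ) ^ 2 + 1) ^ (d - 1) :=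
        mul_le_mul h1 h2 (by positivity) (by positivity)
    _ = ((2 * M ^ 2 + 1) ^ (d - 1) * (2 * M + 1) ^ d : ℕ) := by push_cast; ring

end counting

section assembly
open Polynomial IsCyclotomicExtension Matrix

/-- **Pohoata 2026, Theorem 1.3 via Proposition 5.1**: for a prime `r = 2d + 1 ≥ 5` and every
prime `q > r` with `q ≡ ±1 (mod r)`, the reductions of the points `p_{a,y} = (a + y², y)`,
`a ∈ A`, `y ∈ Y`, form an induced point–line matching in `𝔽_q²` of size
`≥ q^{3/2 - 2/(r-1)} / ((5d)^{3d-2} 2^{d-1})` (the statement of the named fact, spelled out).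
[cite: Pohoata2026SharpExponentMinimalDistance, Thm. 1.3 and Prop. 5.1] -/
theorem exists_inducedMatching :
    ∀ r : ℕ, r.Prime → 5 ≤ r → ∃ c : ℝ, 0 < c ∧ ∃ q₀ : ℕ, ∀ q : ℕ, q.Prime → q₀ ≤ q →
    (q % r = 1 ∨ q % r = r - 1) →
    ∃ V : Finset (Fin 2 → ZMod q), c * (q : ℝ) ^ ((3 : ℝ) / 2 - 2 / ((r : ℝ) - 1)) ≤ V.card ∧
      ∀ v ∈ V, ∃ u : Fin 2 → ZMod q, u ≠ 0 ∧ ∀ w ∈ V, u ⬝ᵥ w = u ⬝ᵥ v → w = v := by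
  intro r hr hr5
  obtain ⟨d, hrd⟩ : ∃ d, r = 2 * d + 1 := hr.odd_of_ne_two (by omega)
  have hd2 : 2 ≤ d := by omega
  haveI : NeZero d := ⟨by omega⟩
  haveI : NeZero r := ⟨by omega⟩
  -- the constant and the threshold
  refine ⟨(((5 * d : ℝ)) ^ (3 * d - 2) * 2 ^ (d - 1))⁻¹, by positivity, r + 1, ?_⟩
  intro q hq hrq hqr
  haveI hqF : Fact q.Prime := ⟨hq⟩
  -- the finite field `F = 𝔽_q(η)`, `η` a primitive `r`-th root of unity
  haveI : NeZero ((r : ℕ) : ZMod q) := ⟨by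
    rw [Ne, ZMod.natCast_eq_zero_iff]   -- `q ∣ r` is impossible
    intro h
    have := Nat.le_of_dvd (by omega) h
    omega⟩
  let F := CyclotomicField r (ZMod q)
  haveI hF : IsCyclotomicExtension {r} (ZMod q) F := CyclotomicField.isCyclotomicExtension r (ZMod q)
  haveI : CharP F q := charP_of_injective_algebraMap (algebraMap (ZMod q) F).injective q
  haveI : NeZero ((r : ℕ) : F) := NeZero.nat_of_injective (algebraMap (ZMod q) F).injective
  set η : F := zeta r (ZMod q) F with hηdef
  have hη : IsPrimitiveRoot η r := zeta_spec r (ZMod q) F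
  have hηr : η ^ r = 1 := hη.pow_eq_one
  -- the real subfield reduces into the prime field: `β i ↦ η^i + η^{-i}`
  have hβex : ∀ i : ℕ, ∃ b : ZMod q, i ≤ r → algebraMap (ZMod q) F b = bb r η i := by
    intro i
    by_cases hi : i ≤ r
    · obtain ⟨b, hb⟩ := bb_mem_range q r hηr hqr (by omega) hi
      exact ⟨b, fun _ => hb⟩
    · exact ⟨0, fun h => absurd h hi⟩
  choose β hβ using hβex
  -- coordinates over `𝔽_q`
  let Yq : (Fin d → ℤ) → ZMod q := fun ν => ∑ i, (ν i : ZMod q) * β (i.1 + 1)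
  let Aq : (Fin d → ℤ) → ZMod q := fun μ => ∑ i, (μ i : ZMod q) * (β (i.1 + 1) - β 1)
  have hYq : ∀ ν, algebraMap (ZMod q) F (Yq ν) = yy r d η ν := by
    intro ν
    simp only [Yq, yy, map_sum, map_mul, map_intCast]
    exact Finset.sum_congr rfl fun i _ => by rw [hβ _ (by omega)]
  have hAq : ∀ μ, algebraMap (ZMod q) F (Aq μ) = aa r d η μ := by
    intro μ
    simp only [Aq, aa, map_sum, map_mul, map_sub, map_intCast]
    exact Finset.sum_congr rfl fun i _ => by rw [hβ _ (by omega), hβ _ (by omega)]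
  -- the points `p_{a,y} = (a + y², y)` on the parabolas `x - y² = a`
  let P : (Fin d → ℤ) × (Fin d → ℤ) → (Fin 2 → ZMod q) :=
    fun mn => ![Aq mn.1 + Yq mn.2 ^ 2, Yq mn.2]
  -- the parameter `M ≈ q^{1/(2d)}` and the boxes
  set s : ℝ := (q : ℝ) ^ (1 / (2 * d : ℝ)) with hs
  have hq0 : (0 : ℝ) < q := by exact_mod_cast hq.pos
  have hs0 : 0 < s := Real.rpow_pos_of_pos hq0 _
  have hsq : s ^ (2 * d) = (q : ℝ) := by
    rw [hs, ← Real.rpow_natCast, ← Real.rpow_mul hq0.le]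
    have : (1 / (2 * d : ℝ)) * ((2 * d : ℕ) : ℝ) = 1 := by
      push_cast
      field_simp
    rw [this, Real.rpow_one]
  set x : ℝ := s / (5 * d) with hx
  have hx0 : 0 ≤ x := by positivity
  set M : ℕ := ⌊x⌋₊ with hM
  have hMx : (M : ℝ) ≤ x := Nat.floor_le hx0
  have hxM : x ≤ M + 1 := (Nat.lt_floor_add_one x).le
  classical
  let boxY : Finset (Fin d → ℤ) := Fintype.piFinset fun _ => Finset.Icc (-(M : ℤ)) M
  let boxA : Finset (Fin d → ℤ) :=
    Fintype.piFinset fun i => if i = 0 then {0} else Finset.Icc (-((M : ℤ) ^ 2)) ((M : ℤ) ^ 2)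
  have hboxY : ∀ n ∈ boxY, ∀ i, |n i| ≤ M := by
    intro n hn i
    have := (Fintype.mem_piFinset.mp hn) i
    rw [Finset.mem_Icc] at this
    exact abs_le.mpr this
  have hboxA0 : ∀ m ∈ boxA, m 0 = 0 := by
    intro m hm
    have := (Fintype.mem_piFinset.mp hm) 0
    simpa using this
  have hboxA : ∀ m ∈ boxA, ∀ i, |m i| ≤ (M : ℤ) ^ 2 := by
    intro m hm i
    have := (Fintype.mem_piFinset.mp hm) i
    by_cases hi : i = 0
    · subst hi
      simp only [if_true, Finset.mem_singleton] at this
      rw [this, abs_zero]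
      positivity
    · rw [if_neg hi, Finset.mem_Icc] at this
      exact abs_le.mpr this
  -- the height bound `H = 24 d² M²` and `H ^ d < q`
  set H : ℕ := 24 * d ^ 2 * M ^ 2 with hH
  have hHs : (H : ℝ) < s ^ 2 := by
    have h1 : (M : ℝ) ^ 2 ≤ x ^ 2 := pow_le_pow_left₀ (Nat.cast_nonneg M) hMx 2
    have h2 : x ^ 2 = s ^ 2 / (25 * d ^ 2) := by rw [hx]; ring
    have h3 : (H : ℝ) ≤ 24 / 25 * s ^ 2 := by
      rw [hH]; push_cast
      calc (24 : ℝ) * d ^ 2 * M ^ 2 ≤ 24 * d ^ 2 * x ^ 2 := by gcongr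
        _ = 24 / 25 * s ^ 2 := by rw [h2]; field_simp
    have h4 : 0 < s ^ 2 := by positivity
    linarith
  have hHq : H ^ d < q := by
    have : (H : ℝ) ^ d < (s ^ 2) ^ d := pow_lt_pow_left₀ hHs (Nat.cast_nonneg H) (by omega)
    rw [← pow_mul, hsq] at this
    exact_mod_cast this
  -- **the induced matching property** (Prop. 5.1): `DD(η) = 0` forces `(a, y) = (a', y')`
  haveI : IsCyclotomicExtension {r} ℚ (CyclotomicField r ℚ) :=
    CyclotomicField.isCyclotomicExtension r ℚ
  have key : ∀ m n m' n', m ∈ boxA → n ∈ boxY → m' ∈ boxA → n' ∈ boxY →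
      DD r d η m n m' n' = 0 → m = m' ∧ n = n' := by
    intro m n m' n' hm hn hm' hn' hD
    by_contra hne
    refine DD_ne_zero_of_reduction r d (CyclotomicField r ℚ) hr hrd hη hHq (hboxA0 m hm)
      (hboxA0 m' hm') (fun w hw hwr => ?_) hne hD
    have hsA : ∀ μ ∈ boxA, ∑ i, |(μ i : ℝ)| ≤ d * (M : ℝ) ^ 2 := by
      intro μ hμ
      calc ∑ i, |(μ i : ℝ)| ≤ ∑ _i : Fin d, (M : ℝ) ^ 2 :=
            Finset.sum_le_sum fun i _ => by exact_mod_cast hboxA μ hμ i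
        _ = d * (M : ℝ) ^ 2 := by simp
    have hsY : ∀ ν ∈ boxY, ∑ i, |(ν i : ℝ)| ≤ d * (M : ℝ) := by
      intro ν hν
      calc ∑ i, |(ν i : ℝ)| ≤ ∑ _i : Fin d, (M : ℝ) :=
            Finset.sum_le_sum fun i _ => by exact_mod_cast hboxY ν hν i
        _ = d * (M : ℝ) := by simp
    calc ‖DD r d w m n m' n'‖ ≤ 8 * (d * (M : ℝ) ^ 2) + 16 * (d * (M : ℝ)) ^ 2 :=
          norm_DD_le r d hw m n m' n' (hsA m hm) (hsA m' hm') (hsY n hn) (hsY n' hn')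
      _ ≤ H := by
          rw [hH]; push_cast
          have hd1 : (1 : ℝ) ≤ d := by exact_mod_cast (show 1 ≤ d by omega)
          nlinarith [sq_nonneg (M : ℝ), mul_nonneg (sub_nonneg.mpr hd1) (sq_nonneg (M : ℝ))]
  -- `DD(η)` is the image of the incidence form over `𝔽_q`
  have hDDq : ∀ m n m' n', algebraMap (ZMod q) F ((Aq m' - Aq m) + (Yq n' - Yq n) ^ 2)
      = DD r d η m n m' n' := by
    intro m n m' n'
    simp only [map_add, map_sub, map_pow, hAq, hYq, DD]
  have key' : ∀ mn ∈ boxA ×ˢ boxY, ∀ mn' ∈ boxA ×ˢ boxY,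
      (Aq mn'.1 - Aq mn.1) + (Yq mn'.2 - Yq mn.2) ^ 2 = 0 → mn = mn' := by
    rintro ⟨m, n⟩ hmn ⟨m', n'⟩ hmn' h0
    rw [Finset.mem_product] at hmn hmn'
    have := key m n m' n' hmn.1 hmn.2 hmn'.1 hmn'.2 (by rw [← hDDq, h0, map_zero])
    exact Prod.ext this.1 this.2
  -- the point set
  refine ⟨(boxA ×ˢ boxY).image P, ?_, ?_⟩
  · -- counting: `|V| = |A| |Y| = (2M²+1)^{d-1} (2M+1)^d ≥ c q^{(3d-2)/(2d)}`
    have hinj : Set.InjOn P ↑(boxA ×ˢ boxY) := by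
      intro mn hmn mn' hmn' hP
      have h2 : Yq mn.2 = Yq mn'.2 := by
        have := congrFun hP 1
        simpa [P] using this
      have h1 : Aq mn.1 + Yq mn.2 ^ 2 = Aq mn'.1 + Yq mn'.2 ^ 2 := by
        have := congrFun hP 0
        simpa [P] using this
      refine key' mn hmn mn' hmn' ?_
      rw [h2] at h1 ⊢
      linear_combination h1.symm
    have hcardY : boxY.card = (2 * M + 1) ^ d := by
      simp only [boxY, Fintype.card_piFinset, Int.card_Icc, Finset.prod_const, Finset.card_univ,
        Fintype.card_fin]
      congr 1
      omega
    have hcardA : boxA.card = (2 * M ^ 2 + 1) ^ (d - 1) := by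
      simp only [boxA, Fintype.card_piFinset]
      rw [← Finset.mul_prod_erase _ _ (Finset.mem_univ (0 : Fin d)), if_pos rfl,
        Finset.card_singleton, one_mul,
        Finset.prod_congr rfl fun i hi => by rw [if_neg (Finset.ne_of_mem_erase hi)],
        Finset.prod_const, Finset.card_erase_of_mem (Finset.mem_univ _), Finset.card_univ,
        Fintype.card_fin, Int.card_Icc]
      have : ((M : ℤ) ^ 2 + 1 - -((M : ℤ) ^ 2)) = ((2 * M ^ 2 + 1 : ℕ) : ℤ) := by push_cast; ring
      rw [this, Int.toNat_natCast]
    rw [Finset.card_image_of_injOn hinj, Finset.card_product, hcardA, hcardY]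
    -- the exponent
    have hexp : (q : ℝ) ^ ((3 : ℝ) / 2 - 2 / ((r : ℝ) - 1)) = s ^ (3 * d - 2) := by
      rw [hs, ← Real.rpow_natCast, ← Real.rpow_mul hq0.le]
      congr 1
      rw [hrd]
      push_cast [Nat.cast_sub (show 2 ≤ 3 * d by omega)]
      have hd0 : (d : ℝ) ≠ 0 := by exact_mod_cast (NeZero.ne d)
      field_simp
      ring
    rw [hexp]
    calc (((5 * d : ℝ)) ^ (3 * d - 2) * 2 ^ (d - 1))⁻¹ * s ^ (3 * d - 2)
          = x ^ (3 * d - 2) / 2 ^ (d - 1) := by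
            rw [hx, div_pow]
            field_simp
      _ ≤ ((2 * M ^ 2 + 1) ^ (d - 1) * (2 * M + 1) ^ d : ℕ) := count_bound d (by omega) x hx0 M hxM
  · -- the matching: the line `{w : w₀ - 2 y w₁ = a - y²}` through `p_{a,y}` meets `V` only there
    intro v hv
    obtain ⟨⟨m, n⟩, hmn, rfl⟩ := Finset.mem_image.mp hv
    refine ⟨![1, -2 * Yq n], ?_, ?_⟩
    · intro h0
      have := congrFun h0 0
      simp at this
    · intro w hw hdot
      obtain ⟨⟨m', n'⟩, hmn', rfl⟩ := Finset.mem_image.mp hw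
      have heq : (Aq m' - Aq m) + (Yq n' - Yq n) ^ 2 = 0 := by
        simp only [P, dotProduct, Fin.sum_univ_two, Matrix.cons_val_zero, Matrix.cons_val_one] at hdot
        linear_combination hdot
      have := key' (m, n) hmn (m', n') hmn' heq
      rw [← this]

end assembly


end Pohoata2026

/-- **Pohoata 2026, Theorem 1.3** (induced point–line matchings over prime fields near exponent
`3/2`, `IM(2,q) ≳_r q^{3/2 - 2/(r-1)}` for primes `q ≡ ±1 (mod r)`): the named fact
`InducedMatchingsNearThreeHalves` holds.
[cite: Pohoata2026SharpExponentMinimalDistance, Thm. 1.3 and Prop. 5.1] -/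
theorem InducedMatchingsNearThreeHalves_holds : InducedMatchingsNearThreeHalves :=
  Pohoata2026.exists_inducedMatching

end Literature.Combinatorics.Extremal
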